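import Mathlib
import HarnessLib
import Summits.HubbardSuperconductivity.HubbardSuperconductivity.Theorems.KLProgrammeKLRegimeSplitEngineV4

/-!
# Route `KLProgramme` — crux K3 split: the two sums child 1 pays for the (T)/(D) terms of the V4 engine slot
# (`thermalBar_sum_le`, `legSliceCount_sum_le`, `legDressBar_sum_le`; cell gate-hubbard-kl, seat p1 = C1 lead, g5)

For the names of record of `KLProgrammeKLRegimeSplitEngineV4` (p444106): along the scale ladder `n = 0, …, N ≤ n_β`,
* the thermal-layer majorants sum geometrically from the bottom: `Σ_{n ≤ N} thermalBar G P U β n ≤ (4/3)·CF·(Klam U)²`;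
* every external leg of a fixed momentum configuration meets the window `[Λ_{n+2}, Λ_{n-2}]` for at most five consecutive `n`
  (two scales `n, n'` in the window of the same leg satisfy `|n − n'| ≤ 4`), so `Σ_{n ≤ N} legSliceCount … n k ≤ 20` and
  `Σ_{n ≤ N} legDressBar G P U (legSliceCount … n k) ≤ 20·CF·(Klam U)²`.
These are the constants child 1's `C_W` absorbs (p1b's gating nod; planner g9's V4 ruling).  Pure arithmetic.
-/

noncomputable section

namespace Summit.HubbardSuperconductivity.HubbardSuperconductivity.Theorems.KLRegimeSplit

set_option linter.dupNamespace false -- summit = problem name (single-conjunct summit), D-0017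

open Real Finset Literature.MathematicalPhysics.QuantumLattice Literature.Probability.LatticeModels
open Summit.HubbardSuperconductivity.HubbardSuperconductivity.Theorems.KLProgrammeLegKernels

/-! ### (T) the thermal layer -/

/-- `Σ_{n ≤ N} 4^{-(n_β - n)} ≤ 4/3` for `N ≤ n_β` (reflect `n ↦ n_β − n` and sum the geometric series). -/
theorem sum_inv_four_pow_reflect_le {Nβ N : ℕ} (hN : N ≤ Nβ) :
    ∑ n ∈ range (N + 1), ((4 : ℝ) ^ (Nβ - n))⁻¹ ≤ 4 / 3 := by
  have hinj : Set.InjOn (fun n => Nβ - n) (range (N + 1) : Finset ℕ) := by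
    intro a ha b hb hab
    simp only [coe_range, Set.mem_Iio] at ha hb
    simp only at hab
    omega
  calc ∑ n ∈ range (N + 1), ((4 : ℝ) ^ (Nβ - n))⁻¹
      = ∑ j ∈ (range (N + 1)).image (fun n => Nβ - n), ((4 : ℝ) ^ j)⁻¹ := by rw [sum_image hinj]
    _ ≤ ∑ j ∈ range (Nβ + 1), ((4 : ℝ) ^ j)⁻¹ := by
        refine sum_le_sum_of_subset_of_nonneg ?_ fun j _ _ => by positivity
        intro j hj
        simp only [mem_image, mem_range] at hj ⊢
        obtain ⟨n, -, rfl⟩ := hj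
        omega
    _ = ∑ j ∈ range (Nβ + 1), ((4 : ℝ)⁻¹) ^ j := sum_congr rfl fun j _ => by rw [inv_pow]
    _ ≤ 4 / 3 := by
        have h := geom_sum_Ico_le_of_lt_one (m := 0) (n := Nβ + 1) (x := (4 : ℝ)⁻¹) (by norm_num) (by norm_num)
        rw [← range_eq_Ico] at h
        refine h.trans ?_
        norm_num

/-- **(T) summed**: `Σ_{n ≤ N} thermalBar G P U β n ≤ (4/3)·CF·(Klam U)²` for `N ≤ n_β`. -/
theorem thermalBar_sum_le {G : GeoConsts} (hG : 0 ≤ G.CF) (P : SplitConsts) (U β : ℝ) {N : ℕ} (hN : N ≤ nScales β) :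
    ∑ n ∈ range (N + 1), thermalBar G P U β n ≤ 4 / 3 * (G.CF * (P.Klam * U) ^ 2) := by
  simp only [thermalBar, ← Finset.mul_sum]
  rw [mul_comm (4 / 3 : ℝ)]
  exact mul_le_mul_of_nonneg_left (sum_inv_four_pow_reflect_le hN) (by positivity)

/-! ### (D) leg dressing: each leg meets at most five consecutive slices -/

/-- Two scales whose windows `[Λ_{n+2}, Λ_{n-2}]` contain the same energy `t` are at most `4` apart (one direction). -/
theorem scale_window_le {t : ℝ} {n n' : ℕ} (hn : klScale klE0 (n + 2) ≤ t) (hn' : t ≤ klScale klE0 (n' - 2)) :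
    n' ≤ n + 4 := by
  have he : (0 : ℝ) < klE0 := by norm_num [klE0]
  have h : klE0 * ((4 : ℝ) ^ (n + 2))⁻¹ ≤ klE0 * ((4 : ℝ) ^ (n' - 2))⁻¹ := hn.trans hn'
  have h' : ((4 : ℝ) ^ (n + 2))⁻¹ ≤ ((4 : ℝ) ^ (n' - 2))⁻¹ := le_of_mul_le_mul_left h he
  have h'' : (4 : ℝ) ^ (n' - 2) ≤ (4 : ℝ) ^ (n + 2) := (inv_le_inv₀ (by positivity) (by positivity)).mp h'
  have h3 : n' - 2 ≤ n + 2 := (pow_le_pow_iff_right₀ (by norm_num : (1 : ℝ) < 4)).mp h''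
  omega

section Model

variable (L M : ℕ) [NeZero L] [NeZero M]

omit [NeZero M] in
/-- For ONE leg energy, the scales `n ≤ N` whose window contains it number at most five. -/
theorem card_scales_in_window_le (t : ℝ) (N : ℕ) :
    ((range (N + 1)).filter fun n => klScale klE0 (n + 2) ≤ t ∧ t ≤ klScale klE0 (n - 2)).card ≤ 5 := by
  set S := (range (N + 1)).filter fun n => klScale klE0 (n + 2) ≤ t ∧ t ≤ klScale klE0 (n - 2) with hS
  by_cases hne : S.Nonempty
  · set m := S.min' hne with hm
    have hmS : m ∈ S := min'_mem S hne
    have hsub : S ⊆ Icc m (m + 4) := by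
      intro n hn
      rw [mem_Icc]
      refine ⟨min'_le S n hn, ?_⟩
      have hn' := (mem_filter.mp hn).2
      have hm' := (mem_filter.mp hmS).2
      exact scale_window_le hm'.1 hn'.2
    calc S.card ≤ (Icc m (m + 4)).card := card_le_card hsub
      _ = 5 := by rw [Nat.card_Icc]; omega
  · rw [not_nonempty_iff_eq_empty.mp hne, card_empty]; norm_num

omit [NeZero L] [NeZero M] in
/-- **(D) summed**: along the ladder a momentum configuration's four legs meet at most `20` slice windows. -/
theorem legSliceCount_sum_le (μ : ℝ) (K : TrigPolyC4v) (k : Fin 4 → TorusSite 2 L) (N : ℕ) :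
    ∑ n ∈ range (N + 1), legSliceCount L μ K n k ≤ 20 := by
  simp only [legSliceCount, Finset.card_filter]
  rw [Finset.sum_comm]
  refine (sum_le_sum (g := fun _ : Fin 4 => 5) fun i _ => ?_).trans (by simp)
  rw [← Finset.card_filter]
  exact card_scales_in_window_le (|nambuXiCT L μ K (k i)|) N

omit [NeZero L] [NeZero M] in
/-- **(D) summed, real form**: `Σ_{n ≤ N} legDressBar G P U (legSliceCount … n k) ≤ 20·CF·(Klam U)²`. -/
theorem legDressBar_sum_le {G : GeoConsts} (hG : 0 ≤ G.CF) (P : SplitConsts) (U μ : ℝ) (K : TrigPolyC4v)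
    (k : Fin 4 → TorusSite 2 L) (N : ℕ) :
    ∑ n ∈ range (N + 1), legDressBar G P U (legSliceCount L μ K n k) ≤ 20 * (G.CF * (P.Klam * U) ^ 2) := by
  simp only [legDressBar, ← Finset.mul_sum]
  rw [mul_comm (20 : ℝ)]
  refine mul_le_mul_of_nonneg_left ?_ (by positivity)
  have h := legSliceCount_sum_le L μ K k N
  exact_mod_cast h

end Model

end Summit.HubbardSuperconductivity.HubbardSuperconductivity.Theorems.KLRegimeSplit

end
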